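import Summits.RiemannHypothesis.RiemannHypothesis.Theorems.NymanBeurlingKernelCertificateRows
import Literature.NumberTheory.LFunctions.BaezDuarteIsometry
import HarnessLib

/-!
# RiemannHypothesis / Nyman–Beurling splittings — the LEVEL CERTIFICATE: `(log 47)·I(47) < 0.28855`
# IN THE KERNEL, via the ζ-side / L²-side dictionary and the tier-47 Gram table

Cell `pub/rh-split`, class (nb, neg), gen 8 (card `cards/SPLIT-nb-neg.md` §14).  The refutation schema of
`Splittings/NbBurnolFloorRunsEval.lean` (`not_nb_halfDoublingTail_of_certificate_em`) kills the half-doubling tail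
`∀ N ≥ H, I(N²) ≤ ½·I(N)` of the Burnol functional
`I(N) = inf_a ∫ |1 − ζ(½+it) Σ_{n<N} a_n (n+1)^{−½−it}|² dt/(¼+t²)` for every `H ≤ N₀` as soon as ONE level value is
certified: `∫ |1 − ζA₀|²/(¼+t²) ≤ c/log N₀` for some Dirichlet polynomial `A₀` of length `N₀` and some `c < 0.28855`
(the kernel-certified Burnol floor of that file).  This file supplies that witness for `N₀ = 47` — the largest length the
floor `0.28855` admits (`2π log N · d_N² = 0.28752 at N = 47`, `0.28880 at N = 48`) — with STANDARD AXIOMS ONLY: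

1. THE DICTIONARY (`lintegral_zetaSide_eq_nbDistSq`, any `N`, real coefficients): for `a_n = −c_n`,
   `∫⁻ |1 − ζ(½+it) Σ a_n (n+1)^{−(½+it)}|²/(¼+t²) dt = 2π · d_N²(c)`, `d_N²(c) = nbDistSq N c = ‖χ − Σ c_k ρ_{k+1}‖²_{L²(0,∞)}`
   — Mellin–Plancherel on the critical line (`Literature.Analysis.FunctionSpaces.integral_norm_sq_mellin_half_eq`) applied to
   the approximant `BaezDuarteU.nbFun` whose Mellin transform is `(1 + ζ(s)Σ c_j (j+1)^{−s})/s` (`BaezDuarteU.hasMellin_nbFun`,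
   Báez-Duarte 2003 (2.4)); the `L²` side is literally `baezDuarteDistSqOf`.
2. THE CHECKER (generic, §2): `levelCheckAt p ct N num` recomputes, with the interval engine of the kernel lineage K
   (`NbKernel.gramTable` = Vasyunin's cotangent formula, `NbKernel.rhsTable`, `logTable`, `MI.pi`), enclosures of the Gram matrix
   and right-hand side at tier `ct.M`, encloses `d²(ỹ_N) = 1 − 2b·ỹ + ỹ·Gỹ` (`NbKernel.qEncl`) for the trial vector `ỹ_N` of the
   certificate `ct`, then `2π · d²(ỹ_N) · log N`, and compares with `num/10⁵`; SOUNDNESS for every tier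
   (`levelConst_lt_of_checkAt`, `level_lintegral_le_at`, `two_pi_log_mul_nbDistSq_lt_of_checkAt`): a passing check proves
   `c_N := 2π d²(ỹ_N) log N < num/10⁵`, the ζ-side integral of `A = −Σ ỹ_{N,n}(n+1)^{−s}` is `≤ c_N/log N`, and
   `2π · d_N² · log N < num/10⁵` for the Báez-Duarte distance itself — so further levels are DATA ONLY (one trial vector each).
3. THE DATA (§3–4): tier 47, `ỹ₄₇ = y47/2^40` (a double-precision solve of the `47 × 47` normal equations, rounded);
   `levelCheck_pass : levelCheckAt prm47 cert47 47 28855 = true` by `decide +kernel` (≈ 4 min kernel time; axioms `propext`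
   only), whence `levelConst_lt`, `level_lintegral_le` — exactly the hypotheses `hc`, `hw` of
   `not_nb_halfDoublingTail_of_certificate_em` with `N₀ = 47` — and `two_pi_log_mul_nbDistSq_47_lt`; the corollary
   `¬ TailDoubling(½, H)` for all `H ≤ 47` is drawn in `Splittings/NbHalfDoublingRefuted.lean` (which imports the floor file).
   Admissible levels (value `2π log N · d_N² < 0.28855`) come in bands `41–47, 222–266, 291–331, 444–482, 590–1589, …`
   (hub table); tier 47 is the last one within `decide +kernel` reach, higher bands are `native_decide` rows.

RH-FREE: an identity of absolutely convergent integrals, interval arithmetic on classical constants, and one inequality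
between two real numbers; nothing here bears on `d_N → 0` or on the truth of RH.

References: L. Báez-Duarte, Rend. Lincei (9) 14 (2003) 5–11, §2.2 (2.4); J.-F. Burnol, Adv. Math. 170 (2002) 56–70, §3
(the isometry); B. Landreau – F. Richard, Experiment. Math. 11 (2002) 349–360, Thm 2.1 (Vasyunin's formula; their Table 1 is
the float lineage of `d_N²`); E. C. Titchmarsh, Fourier Integrals (1948) Thm 71.
-/

set_option linter.dupNamespace false

namespace Summit.RiemannHypothesis.RiemannHypothesis.Theorems.Splittings.NbLevelCertificate

open MeasureTheory Set Complex Finset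
open scoped Matrix
open Summit.RiemannHypothesis.RiemannHypothesis.Theorems.NbTheory
open Summit.RiemannHypothesis.RiemannHypothesis.Theorems.NbTheory.NbKernel
open Literature.NumberTheory.LFunctions
open Literature.Analysis.ValidatedNumerics Literature.Analysis.ValidatedNumerics.NumericsMP

/-! ## 1. The ζ-side / L²-side dictionary -/

/-- The dilations of the Báez-Duarte problem: `a_j = j + 1`. -/
def bdDil (N : ℕ) : Fin N → ℝ := fun j ↦ ((j : ℕ) : ℝ) + 1

/-- The Báez-Duarte dilation parameters are at least `1`. -/
theorem one_le_bdDil (N : ℕ) : ∀ j : Fin N, 1 ≤ bdDil N j := fun j ↦ by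
  simp only [bdDil, le_add_iff_nonneg_left, Nat.cast_nonneg]

/-- The Báez-Duarte dilation parameters are positive. -/
theorem bdDil_pos (N : ℕ) : ∀ j : Fin N, 0 < bdDil N j := fun j ↦ by
  have := one_le_bdDil N j; linarith

/-- The `L²` side: `∫_0^∞ |χ − Σ c_k ρ_{k+1}|² = d_N²(c)` (`nbDistSq` is by definition the `toReal` of the lower
integral `baezDuarteDistSqOf`; the approximant is square integrable, `BaezDuarteU.integrableOn_norm_sq_nbFun`). -/
theorem integral_norm_sq_nbFun_eq_nbDistSq (N : ℕ) (c : Fin N → ℝ) :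
    ∫ t in Ioi (0 : ℝ), ‖BaezDuarteU.nbFun (bdDil N) c t‖ ^ 2 = nbDistSq N c := by
  have hpt : ∀ t : ℝ, ‖BaezDuarteU.nbFun (bdDil N) c t‖ ^ 2 =
      ((Ioc (0 : ℝ) 1).indicator 1 t - ∑ k : Fin N, c k * Int.fract (1 / (((k : ℕ) + 1 : ℝ) * t))) ^ 2 := by
    intro t
    rw [BaezDuarteU.nbFun, Complex.norm_real, Real.norm_eq_abs, sq_abs]
    rfl
  have hint : IntegrableOn (fun t : ℝ ↦ ((Ioc (0 : ℝ) 1).indicator 1 t -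
      ∑ k : Fin N, c k * Int.fract (1 / (((k : ℕ) + 1 : ℝ) * t))) ^ 2) (Ioi 0) :=
    (BaezDuarteU.integrableOn_norm_sq_nbFun (bdDil N) c (one_le_bdDil N)).congr_fun (fun t _ ↦ hpt t)
      measurableSet_Ioi
  rw [nbDistSq, baezDuarteDistSqOf_eq, ← ofReal_integral_eq_lintegral_ofReal hint (ae_of_all _ fun t ↦ sq_nonneg _),
    ENNReal.toReal_ofReal (setIntegral_nonneg measurableSet_Ioi fun t _ ↦ sq_nonneg _)]
  exact setIntegral_congr_fun measurableSet_Ioi fun t _ ↦ hpt t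

/-- The ζ side, pointwise on the critical line: `|1 − ζ(s) Σ (−c_n)(n+1)^{−s}|²/|s|² = |M[f](s)|²`, `s = ½ + it`,
`f = χ − Σ c_k ρ_{k+1}` (Báez-Duarte 2003, (2.4)). -/
theorem zetaSide_pointwise (N : ℕ) (c : Fin N → ℝ) (t : ℝ) :
    ‖1 - riemannZeta (1 / 2 + t * I) *
        ∑ n : Fin N, (-((c n : ℝ) : ℂ)) * ((n : ℂ) + 1) ^ (-(1 / 2 + t * I))‖ ^ 2 / (1 / 4 + t ^ 2) =
      ‖mellin (BaezDuarteU.nbFun (bdDil N) c) (1 / 2 + t * I)‖ ^ 2 := by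
  rw [(BaezDuarteU.hasMellin_nbFun (bdDil N) c (bdDil_pos N) (s := 1 / 2 + t * I) (by simp)
    (by simp; norm_num)).2, norm_div, div_pow]
  have hn : ‖(1 / 2 + t * I : ℂ)‖ ^ 2 = 1 / 4 + t ^ 2 := by
    rw [Complex.sq_norm, show (1 / 2 + t * I : ℂ) = ((1 / 2 : ℝ) : ℂ) + (t : ℝ) * I by push_cast; ring,
      Complex.normSq_add_mul_I]
    norm_num
  rw [hn]
  congr 2
  unfold BaezDuarteU.dirichletSum bdDil
  push_cast
  simp only [neg_mul, Finset.sum_neg_distrib, mul_neg, sub_neg_eq_add]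

/-- **THE DICTIONARY.**  For real coefficients `c` and `a_n = −c_n`:
`∫⁻ |1 − ζ(½+it) Σ_{n<N} a_n (n+1)^{−(½+it)}|²/(¼+t²) dt = 2π · d_N²(c)` (Mellin–Plancherel on the critical line). -/
theorem lintegral_zetaSide_eq_nbDistSq (N : ℕ) (c : Fin N → ℝ) :
    ∫⁻ t : ℝ, ENNReal.ofReal (‖1 - riemannZeta (1 / 2 + t * I) *
        ∑ n : Fin N, (-((c n : ℝ) : ℂ)) * ((n : ℂ) + 1) ^ (-(1 / 2 + t * I))‖ ^ 2 / (1 / 4 + t ^ 2)) =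
      ENNReal.ofReal (2 * Real.pi * nbDistSq N c) := by
  obtain ⟨hI, hP⟩ := Literature.Analysis.FunctionSpaces.integral_norm_sq_mellin_half_eq
    (BaezDuarteU.mellinConvergent_nbFun_half (bdDil N) c (one_le_bdDil N))
    (BaezDuarteU.integrableOn_norm_sq_nbFun (bdDil N) c (one_le_bdDil N))
  simp_rw [zetaSide_pointwise]
  rw [← ofReal_integral_eq_lintegral_ofReal hI (ae_of_all _ fun t ↦ sq_nonneg _), hP,
    integral_norm_sq_nbFun_eq_nbDistSq]

/-- Corollary: the ζ-side value of ANY real Dirichlet polynomial bounds `2π d_N²` from above … and conversely the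
level values are `2π d_N²(c)`; in particular `I(N) ≤ 2π d_N²(c)` for every real `c`. -/
theorem lintegral_zetaSide_le_of_nbDistSq_le {N : ℕ} (c : Fin N → ℝ) {D : ℝ} (hD : nbDistSq N c ≤ D) :
    ∫⁻ t : ℝ, ENNReal.ofReal (‖1 - riemannZeta (1 / 2 + t * I) *
        ∑ n : Fin N, (-((c n : ℝ) : ℂ)) * ((n : ℂ) + 1) ^ (-(1 / 2 + t * I))‖ ^ 2 / (1 / 4 + t ^ 2)) ≤
      ENNReal.ofReal (2 * Real.pi * D) := by
  rw [lintegral_zetaSide_eq_nbDistSq]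
  exact ENNReal.ofReal_le_ofReal (by nlinarith [Real.pi_pos])

/-! ## 2. The generic level checker and its soundness -/

/-- **The level checker** (a closed Boolean once its arguments are literals): with engine parameters `p`, a certificate `ct`
of tier `ct.M` carrying a trial vector `ỹ_N = trial ct N` in row `N ≤ ct.M`, and a threshold `num/10⁵`: compute `π ∈ piI`,
`log 2π − γ ∈ c0`, `log N ∈ L`, the tables `G ∋ (⟨ρ_{j+1},ρ_{k+1}⟩)_{j,k<N}` (Vasyunin), `B ∋ (b_k)_{k<N}`, enclose
`Q ∋ d²(ỹ_N) = 1 − 2B·ỹ + ỹ·Gỹ` and test `hi(2·piI·Q·L) · 10⁵ < num · S`. -/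
def levelCheckAt (p : Params) (ct : Cert) (N num : ℕ) : Bool :=
  match MI.pi p.S p.KATAN with
  | some piI =>
    match l2pigEncl p.S p.KLOG piI, lget (logTable p.S p.KLOG ct.M) N with
    | some c0, some L =>
      match byEncl ct (rhsTable p.S ct.M (logTable p.S p.KLOG ct.M)) N,
        ygyEncl ct (gramTable p.S ct.M (cotTable p.S p.KEXP p.KSQ ct.M piI) (logTable p.S p.KLOG ct.M) c0 piI) N with
      | some l, some qd =>
        decide (0 < p.S) &&
          decide ((MI.mul p.S (MI.mul p.S (piI.mulInt 2) (qEncl p ct l qd)) L).hi * 100000 < (num : ℤ) * (p.S : ℤ))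
      | _, _ => false
    | _, _ => false
  | none => false

/-- The level constant `c_N = 2π · d²(ỹ_N) · log N` of the trial vector `ỹ_N = trial ct N`. -/
noncomputable def levelConst (ct : Cert) (N : ℕ) : ℝ :=
  2 * Real.pi * nbDistSq N (trial ct N) * Real.log ((N : ℕ) : ℝ)

/-- **Soundness of the level checker (RH-FREE, every tier)**: a passing `levelCheckAt p ct N num` proves `c_N < num/10⁵`. -/
theorem levelConst_lt_of_checkAt {p : Params} {ct : Cert} {N num : ℕ} (hN : N ≤ ct.M)
    (h : levelCheckAt p ct N num = true) : levelConst ct N < (num : ℝ) / 100000 := by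
  unfold levelCheckAt at h
  split at h
  · rename_i piI hpi
    split at h
    · rename_i c0 L hc0 hL
      split at h
      · rename_i l qd hl hqd
        simp only [Bool.and_eq_true, decide_eq_true_eq] at h
        obtain ⟨hS, hlt⟩ := h
        have hSr : (0 : ℝ) < p.S := by exact_mod_cast hS
        have mpi := MI.mem_pi p.S hpi
        have mc0 := mem_l2pigEncl hS mpi hc0
        have mL : MI.mem p.S (Real.log ((N : ℕ) : ℝ)) L := mem_lget_logTable hS hN hL
        have hG : GramOK p ct (gramTable p.S ct.M (cotTable p.S p.KEXP p.KSQ ct.M piI) (logTable p.S p.KLOG ct.M) c0 piI) :=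
          fun j k hj hk Y hY ↦ mem_gget_gramTable hS mpi mc0 hj hk hY
        have hB : RhsOK p ct (rhsTable p.S ct.M (logTable p.S p.KLOG ct.M)) :=
          fun k hk Y hY ↦ mem_lget_rhsTable hS hk hY
        -- the quadratic form at the trial vector (as in `NbKernel.rowCheck_sound`)
        have hQ : MI.mem p.S (nbDistSq N (trial ct N)) (qEncl p ct l qd) := by
          have ml := mem_byEncl hB hN hl
          have mq := mem_ygyEncl hG hN hqd
          have m := MI.mem_add (MI.mem_sub (MI.mem_ofInt p.S 1) (MI.mem_divNat (MI.mem_mulInt ml 2)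
            (n := 2 ^ ct.TB) (by positivity))) (MI.mem_divNat mq (n := 2 ^ (2 * ct.TB)) (by positivity))
          have eL : ∑ k : Fin N, trial ct N k * nbRhs k =
              (∑ k ∈ Finset.range N, nbRhs k * (yget ct N k : ℝ)) / 2 ^ ct.TB := by
            rw [Finset.sum_range (fun k ↦ nbRhs k * (yget ct N k : ℝ)), Finset.sum_div]
            exact Finset.sum_congr rfl fun k _ ↦ by simp only [trial]; ring
          have eQ : trial ct N ⬝ᵥ (nbGramMatrix N *ᵥ trial ct N) =
              (∑ k ∈ Finset.range N, (∑ j ∈ Finset.range N, nbGram k j * (yget ct N j : ℝ)) *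
                (yget ct N k : ℝ)) / 2 ^ (2 * ct.TB) := by
            rw [Finset.sum_range (fun k ↦ (∑ j ∈ Finset.range N, nbGram k j * (yget ct N j : ℝ)) *
              (yget ct N k : ℝ)), Finset.sum_div]
            simp only [dotProduct, Matrix.mulVec, nbGramMatrix, Matrix.of_apply]
            refine Finset.sum_congr rfl fun k _ ↦ ?_
            rw [Finset.sum_range (fun j ↦ nbGram k j * (yget ct N j : ℝ)), Finset.mul_sum, Finset.sum_mul,
              Finset.sum_div]
            refine Finset.sum_congr rfl fun j _ ↦ ?_
            simp only [trial]
            rw [pow_mul']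
            ring
          have e : nbDistSq N (trial ct N) = ((1 : ℤ) : ℝ) -
              (∑ k ∈ Finset.range N, nbRhs k * (yget ct N k : ℝ)) * ((2 : ℤ) : ℝ) / ((2 ^ ct.TB : ℕ) : ℝ) +
              (∑ k ∈ Finset.range N, (∑ j ∈ Finset.range N, nbGram k j * (yget ct N j : ℝ)) *
                (yget ct N k : ℝ)) / ((2 ^ (2 * ct.TB) : ℕ) : ℝ) := by
            rw [Minimiser.nbDistSq_eq_quadratic, eL, eQ]
            push_cast
            ring
          rw [e]; exact m
        have m := MI.mem_mul hS (MI.mem_mul hS (MI.mem_mulInt mpi 2) hQ) mL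
        have e : Real.pi * ((2 : ℤ) : ℝ) * nbDistSq N (trial ct N) * Real.log ((N : ℕ) : ℝ) = levelConst ct N := by
          unfold levelConst; push_cast; ring
        rw [e] at m
        have hhi := MI.le_hi_div hS m
        have hltr : (((MI.mul p.S (MI.mul p.S (piI.mulInt 2) (qEncl p ct l qd)) L).hi : ℤ) : ℝ) * 100000 <
            (num : ℝ) * (p.S : ℝ) := by
          exact_mod_cast hlt
        calc levelConst ct N ≤ _ := hhi
          _ < (num : ℝ) / 100000 := by
            rw [div_lt_div_iff₀ hSr (by norm_num)]
            linarith
      · simp at h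
    · simp at h
  · simp at h

/-- The ζ-side value of `A = −Σ_{n<N} ỹ_{N,n}(n+1)^{−s}` is AT MOST `c_N/log N` (it is equal, by the dictionary of §1; `N ≥ 2`). -/
theorem level_lintegral_le_at (ct : Cert) {N : ℕ} (hN : 1 < N) :
    ∫⁻ t : ℝ, ENNReal.ofReal (‖1 - riemannZeta (1 / 2 + t * I) *
        ∑ n : Fin N, (-((trial ct N n : ℝ) : ℂ)) * ((n : ℂ) + 1) ^ (-(1 / 2 + t * I))‖ ^ 2 / (1 / 4 + t ^ 2)) ≤
      ENNReal.ofReal (levelConst ct N / Real.log ((N : ℕ) : ℝ)) := by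
  rw [lintegral_zetaSide_eq_nbDistSq]
  apply le_of_eq
  congr 1
  have h1 : (1 : ℝ) < ((N : ℕ) : ℝ) := by exact_mod_cast hN
  have hlog : Real.log ((N : ℕ) : ℝ) ≠ 0 := (Real.log_pos h1).ne'
  rw [levelConst, mul_div_assoc, div_self hlog, mul_one]

/-- From a passing check to the Báez-Duarte distance itself: `2π · d_N² · log N < num/10⁵` (`d_N² ≤ d²(ỹ_N)` by minimality,
`NbTheory.nbDistSq_nbMinimiser_le`). -/
theorem two_pi_log_mul_nbDistSq_lt_of_checkAt {p : Params} {ct : Cert} {N num : ℕ} (hN : N ≤ ct.M) (h1 : 1 ≤ N)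
    (h : levelCheckAt p ct N num = true) :
    2 * Real.pi * nbDistSq N (nbMinimiser N) * Real.log ((N : ℕ) : ℝ) < (num : ℝ) / 100000 := by
  have hmin : nbDistSq N (nbMinimiser N) ≤ nbDistSq N (trial ct N) := nbDistSq_nbMinimiser_le (trial ct N)
  have hlog : 0 ≤ Real.log ((N : ℕ) : ℝ) := Real.log_nonneg (by exact_mod_cast h1)
  have hlt := levelConst_lt_of_checkAt hN h
  unfold levelConst at hlt
  exact (mul_le_mul_of_nonneg_right (mul_le_mul_of_nonneg_left hmin (by positivity)) hlog).trans_lt hlt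

/-! ## 3. The data: tier 47 -/

/-- The trial vector `y₄₇` (numerators at scale `2^40`): a double-precision solve of the `47 × 47` normal equations
`G c = b` with Vasyunin's Gram matrix, rounded (`d²(ỹ₄₇) = 0.011885203…`, `2π log 47 · d² = 0.287517…`). -/
def y47 : List ℤ :=
  [-1062044335542, 1039603246518, 1026546124584, 109478892926, 901072184860, -734502950992, 821571078739,
    -17514098050, 53502491748, -638719688692, 687187466619, -102875430358, 660633452453, -540886705063,
    -580741094372, 66120196644, 522293822789, -66771725296, 505130563695, 19654440100, -568867481835,
    -420526670154, 566375328414, 43086688970, -34267271749, -392754085639, 20256720712, -148565053404,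
    293233955684, 508421181779, 320687185031, -63245853222, -325008710371, -332755429032, -294256404925,
    122445586907, 376483763362, -390312579776, -353546508245, -35015043474, 298605887685, 452366858676,
    229710355215, -44252099401, -17275087709, -458610404319, 191408675981]

/-- The one-row certificate: tier `M = 47`, trial vector `ỹ₄₇ = y₄₇/2^40` in row 47 (no Cholesky data, no claims — unused). -/
def cert47 : Cert := ⟨47, 0, [], 0, 1, 40, List.replicate 46 [] ++ [y47], [], [], []⟩

/-- Engine parameters (those of the tier-32 table `NbKernel.prm32`: scale `2^128`, 130 log-series terms, 95 arctan terms,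
22 Taylor terms, 5 halvings). -/
def prm47 : Params := ⟨2 ^ 128, 130, 95, 22, 5⟩

/-! ## 4. Kernel evaluation at tier 47 and the unconditional statements -/

/-- **The tier-47 level check passes** (`decide +kernel`, ≈ 4 min of kernel time; axioms: `propext`). -/
theorem levelCheck_pass : levelCheckAt prm47 cert47 47 28855 = true := by
  decide +kernel

/-- **`c₄₇ = 2π d²(ỹ₄₇) log 47 < 0.28855`** (RH-FREE, standard axioms). -/
theorem levelConst_lt : levelConst cert47 47 < 28855 / 100000 := by
  exact_mod_cast levelConst_lt_of_checkAt (le_rfl : 47 ≤ cert47.M) levelCheck_pass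

/-- The ζ-side value of `A₀ = −Σ_{n<47} ỹ_{47,n}(n+1)^{−s}` is at most `c₄₇/log 47` — the hypothesis `hw` of
`NbBurnolFloorRuns.not_nb_halfDoublingTail_of_certificate_em` at `N₀ = 47`. -/
theorem level_lintegral_le :
    ∫⁻ t : ℝ, ENNReal.ofReal (‖1 - riemannZeta (1 / 2 + t * I) *
        ∑ n : Fin 47, (-((trial cert47 47 n : ℝ) : ℂ)) * ((n : ℂ) + 1) ^ (-(1 / 2 + t * I))‖ ^ 2 / (1 / 4 + t ^ 2)) ≤
      ENNReal.ofReal (levelConst cert47 47 / Real.log ((47 : ℕ) : ℝ)) :=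
  level_lintegral_le_at cert47 (by norm_num)

/-- **`(log 47) · 2π d_47² < 0.28855`**: the Báez-Duarte distance at `N = 47` itself (RH-FREE, standard axioms). -/
theorem two_pi_log_mul_nbDistSq_47_lt :
    2 * Real.pi * nbDistSq 47 (nbMinimiser 47) * Real.log ((47 : ℕ) : ℝ) < 28855 / 100000 := by
  exact_mod_cast two_pi_log_mul_nbDistSq_lt_of_checkAt (le_rfl : 47 ≤ cert47.M) (by norm_num) levelCheck_pass

end Summit.RiemannHypothesis.RiemannHypothesis.Theorems.Splittings.NbLevelCertificate
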